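import Summits.Ventures.LatticeQCDFlow.Scaling.DoeblinHotSampler
import Summits.Ventures.LatticeQCDFlow.Scaling.DominatedStarMixingLaw

/-!
HONEST FRAMING: exact (Metropolis-corrected) sampling algorithms for lattice gauge theory; figures
of merit are autocorrelation/cost numbers at stated couplings and volumes; no continuum-physics
claim.

# DoeblinHotMixingLaw — THE `K·log K` LAW FROM BOTH SIDES SURVIVES A DOEBLIN-MINORISED HOT SAMPLER:
# `(K/θ_Σ − 1)·log(K/4) ≤ t_mix(1/4) ≤ ⌈(2m/(tcp))·log((2K+p)/(p/4))⌉` ONCE `4t ≤ p(1−t)·a·w_0`; AT UNIFORM LISTING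
# `m = cK` THE UNIT IS `2K/(tp)`; THE TUNED HOT-ONLY STAR NOW SWAPS WITH FRACTION `t = pa/(4+pa)` AND MIXES IN
# `((4+pa)K/(pa) − 1)·log(K/4) ≤ t_mix(1/4) ≤ ⌈(2(4+pa)K/(p²a))·log((2K+p)/(p/4))⌉` (lean-2 GEN-27, ours)

Venture-side (OURS).  Cell `lqcd-flow` (pub-lqcd), unit `pub-lqcd-lean-2-g27`, 2026-08-27.  Doeblin-minorised hot
samplers, file 9.  Setting of `Scaling/DoeblinHotSampler` (chapter M's scheme `P = t·GSw + (1−t)·Π_w^M` with a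
`μ_0`-stationary hot kernel `M_0(u,·) ≥ a·μ_0(·)`, `0 < a ≤ 1`; here all single-site kernels `μ_k`-reversible);
`θ_Σ = t + (1−t)(1−w_0)` the touch-rate sum of `Scaling/HubCollectorLaw`, whose coupon-collector FLOOR needs no
exactness of the hot sampler and is imported verbatim.

## What is proved

* §1 **`doeblinStar_mixingTime_two_sided`** (`K ≥ 2`, a start `x` with `Σ_k μ_{k+1}(x_{k+1}) ≤ 1/4`):
  `(K/θ_Σ − 1)·log(K/4) ≤ t_mix(1/4) ≤ ⌈(2m/(tcp))·log((2K+p)/(p·(1/4)))⌉`;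
  **`doeblinStar_mixingTime_two_sided_of_card`** (`K ≥ 4`, `|S| ≥ 4K`): `(K − 1)·log(K/4) ≤ t_mix(1/4) ≤ …`;
  **`doeblinStar_mixingTime_le_uniform`** (`m = cK`): `t_mix(ε) ≤ ⌈(2K/(tp))·log((2K+p)/(pε))⌉`.
* §2 the tuned hot-only star (`w_0 = 1`, `t = pa/(4+pa)` — the regime with equality — `m = cK`):
  **`doeblinTunedStar_mixingTime_two_sided`**
  `((4+pa)K/(pa) − 1)·log(K/4) ≤ t_mix(1/4) ≤ ⌈(2(4+pa)K/(p²a))·log((2K+p)/(p·(1/4)))⌉`;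
  **`doeblinTunedStar_mixingTime_two_sided_of_card`** (`K ≥ 4`, `|S| ≥ 4K`; floor recorded as `(K−1)·log(K/4)`).

Reading (no numerics implied): an imperfect (Metropolised-flow) hot sampler with acceptance floor `a` forces the
swap fraction down to `t ≈ pa/4` and so multiplies the provable ceiling's constant by `1/a`
(`2(4+pa)K/(p²a)` against chapter M's `2(4+p)K/p²`), while the collector floor is untouched: the law stays
`K·log K`, the sampler quality joins the transport quality in the constant only.  NOT CLAIMED: that the `1/a` is
necessary (it enters through the conservative regime); anything measured.  Literature grade (cell rule): OWN
RESULT; nothing cited as a fact; no new bib keys.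
-/

noncomputable section

open Finset Function
open Literature.Probability.MarkovChains

namespace Summit.Ventures.LatticeQCDFlow.Scaling

variable {S : Type*} [Fintype S] [DecidableEq S] {K m : ℕ} {μ : Fin (K + 1) → S → ℝ} {M : Fin (K + 1) → S → S → ℝ}
  {w : Fin (K + 1) → ℝ} {t p a : ℝ}

section Law
variable (κ : Fin m → Fin K) (φ : Fin m → Equiv.Perm S)

/-! ## §1 The law from both sides and uniform listing -/

/-- **THE `K·log K` LAW WITH A DOEBLIN-MINORISED HOT SAMPLER, BOTH SIDES:** `K ≥ 2`, `m ≥ 1`, `0 < t ≤ 1`,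
reversible single-site kernels, `M_0(u,·) ≥ a·μ_0` (`0 < a ≤ 1`), one-sided domination (`0 < p ≤ 1`),
`4t ≤ p(1−t)·a·w_0`, hub multiplicities `≥ c ≥ 1`, a start `x` with `Σ_k μ_{k+1}(x_{k+1}) ≤ 1/4`:
**`(K/(t + (1−t)(1−w_0)) − 1)·log(K/4) ≤ t_mix(1/4) ≤ ⌈(2m/(tcp))·log((2K+p)/(p·(1/4)))⌉`.** [ours] -/
theorem doeblinStar_mixingTime_two_sided (hK : 2 ≤ K) (hm : 1 ≤ m) (ht0 : 0 < t) (ht1 : t ≤ 1) (hw0 : ∀ k, 0 ≤ w k)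
    (hw1 : ∑ k, w k = 1) (hμ : ∀ k x, 0 < μ k x) (hμ1 : ∀ k, ∑ u, μ k u = 1) (hM : ∀ k, IsRowStochastic (M k))
    (hMrev : ∀ k, DetailedBalance (μ k) (M k)) (ha0 : 0 < a) (ha1 : a ≤ 1) (hmin : ∀ u v, a * μ 0 v ≤ M 0 u v)
    (hp0 : 0 < p) (hp1 : p ≤ 1) (hdom : ∀ r u, p * μ (κ r).succ (φ r u) ≤ μ 0 u)
    (hreg : 4 * t ≤ p * (1 - t) * (a * w 0))
    {c : ℕ} (hc1 : 1 ≤ c) (hc : ∀ p' : Fin K, c ≤ (univ.filter (fun r : Fin m => κ r = p')).card) (hcm : c ≤ m)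
    (x : Fin (K + 1) → S) (hx : ∑ k : Fin K, μ k.succ (x k.succ) ≤ 1 / 4) :
    ((K : ℝ) / (t + (1 - t) * (1 - w 0)) - 1) * Real.log (K / 4)
        ≤ (mixingTime (fun y z : Fin (K + 1) → S =>
            t * ptGraphSwap μ (fun r : Fin m => (((0 : Fin (K + 1)), (κ r).succ) : Fin (K + 1) × Fin (K + 1))) φ y z
              + (1 - t) * prodKernel w M y z) (tensorFun μ) (1 / 4) : ℝ) ∧
      mixingTime (fun y z : Fin (K + 1) → S =>
            t * ptGraphSwap μ (fun r : Fin m => (((0 : Fin (K + 1)), (κ r).succ) : Fin (K + 1) × Fin (K + 1))) φ y z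
              + (1 - t) * prodKernel w M y z) (tensorFun μ) (1 / 4)
        ≤ ⌈2 * (m : ℝ) / (t * c * p) * Real.log ((2 * (K : ℝ) + p) / (p * (1 / 4)))⌉₊ := by
  have hstat : ∀ (k : Fin (K + 1)) (v : S), ∑ u, μ k u * M k u v = μ k v := fun k v => (hMrev k).isStationary (hM k).2 v
  refine ⟨?_, doeblinStar_mixingTime_le κ φ hm ht0 ht1 hw0 hw1 hμ hμ1 hM hstat ha0 ha1 hmin hp0 hp1 hdom hreg hc1 hc hcm
    (by norm_num)⟩
  have hmix : ∃ t₀, worstTvDist (fun y z : Fin (K + 1) → S =>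
      t * ptGraphSwap μ (fun r : Fin m => (((0 : Fin (K + 1)), (κ r).succ) : Fin (K + 1) × Fin (K + 1))) φ y z
        + (1 - t) * prodKernel w M y z) (tensorFun μ) t₀ ≤ 1 / 4 := by
    refine ⟨⌈2 * (m : ℝ) / (t * c * p) * Real.log ((2 * (K : ℝ) + p) / (p * (1 / 4)))⌉₊, ?_⟩
    refine (doeblinStar_worstTvDist_le κ φ hm ht0.le ht1 hw0 hw1 hμ hμ1 hM hstat ha0 ha1 hmin hp0 hp1 hdom hreg hc1 hc
      hcm _).trans ?_
    have hmpos : (0 : ℝ) < m := Nat.cast_pos.mpr (by omega)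
    have hcpos : (0 : ℝ) < c := Nat.cast_pos.mpr (by omega)
    have hcm' : (c : ℝ) ≤ m := by exact_mod_cast hcm
    have hq0 : 0 < t * c * p / (2 * m) := by positivity
    have hq1 : t * c * p / (2 * m) ≤ 1 := by
      rw [div_le_one (by positivity)]
      have h1 : t * c ≤ 1 * m := by nlinarith
      nlinarith
    have hC : 0 < (2 * (K : ℝ) + p) / p := by positivity
    refine geom_le_of_ge_log hq0 hq1 hC (by norm_num : (0 : ℝ) < 1 / 4) ?_
    have e1 : 1 / (t * c * p / (2 * m)) = 2 * (m : ℝ) / (t * c * p) := by field_simp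
    have e2 : (2 * (K : ℝ) + p) / p / (1 / 4) = (2 * (K : ℝ) + p) / (p * (1 / 4)) := by rw [div_div]
    rw [e1, e2]; exact Nat.le_ceil _
  exact hubList_mixingTime_ge_quarter κ φ hK hm hμ hμ1 hM hMrev hw0 hw1 ht0.le ht1
    (touchRateSum_pos ht0 ht1 (weight_zero_le_one hw0 hw1)) x hx hmix

/-- **THE LAW ON A LARGE CONFIGURATION SPACE (`|S| ≥ 4K`, `K ≥ 4`) WITH A DOEBLIN-MINORISED HOT SAMPLER:** the rare
start supplied — **`(K − 1)·log(K/4) ≤ t_mix(1/4) ≤ ⌈(2m/(tcp))·log((2K+p)/(p·(1/4)))⌉`.** [ours] -/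
theorem doeblinStar_mixingTime_two_sided_of_card (hK : 4 ≤ K) (hS : 4 * K ≤ Fintype.card S) (hm : 1 ≤ m)
    (ht0 : 0 < t) (ht1 : t ≤ 1) (hw0 : ∀ k, 0 ≤ w k) (hw1 : ∑ k, w k = 1) (hμ : ∀ k x, 0 < μ k x)
    (hμ1 : ∀ k, ∑ u, μ k u = 1) (hM : ∀ k, IsRowStochastic (M k)) (hMrev : ∀ k, DetailedBalance (μ k) (M k))
    (ha0 : 0 < a) (ha1 : a ≤ 1) (hmin : ∀ u v, a * μ 0 v ≤ M 0 u v)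
    (hp0 : 0 < p) (hp1 : p ≤ 1) (hdom : ∀ r u, p * μ (κ r).succ (φ r u) ≤ μ 0 u)
    (hreg : 4 * t ≤ p * (1 - t) * (a * w 0))
    {c : ℕ} (hc1 : 1 ≤ c) (hc : ∀ p' : Fin K, c ≤ (univ.filter (fun r : Fin m => κ r = p')).card) (hcm : c ≤ m) :
    ((K : ℝ) - 1) * Real.log (K / 4)
        ≤ (mixingTime (fun y z : Fin (K + 1) → S =>
            t * ptGraphSwap μ (fun r : Fin m => (((0 : Fin (K + 1)), (κ r).succ) : Fin (K + 1) × Fin (K + 1))) φ y z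
              + (1 - t) * prodKernel w M y z) (tensorFun μ) (1 / 4) : ℝ) ∧
      mixingTime (fun y z : Fin (K + 1) → S =>
            t * ptGraphSwap μ (fun r : Fin m => (((0 : Fin (K + 1)), (κ r).succ) : Fin (K + 1) × Fin (K + 1))) φ y z
              + (1 - t) * prodKernel w M y z) (tensorFun μ) (1 / 4)
        ≤ ⌈2 * (m : ℝ) / (t * c * p) * Real.log ((2 * (K : ℝ) + p) / (p * (1 / 4)))⌉₊ := by
  obtain ⟨x, hx⟩ := exists_rare_coldStart (μ := μ) hμ1 hS
  obtain ⟨hlo, hhi⟩ := doeblinStar_mixingTime_two_sided κ φ (by omega) hm ht0 ht1 hw0 hw1 hμ hμ1 hM hMrev ha0 ha1 hmin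
    hp0 hp1 hdom hreg hc1 hc hcm x hx
  refine ⟨le_trans ?_ hlo, hhi⟩
  have hK4 : (4 : ℝ) ≤ K := by exact_mod_cast hK
  have hlog : 0 ≤ Real.log (K / 4) := Real.log_nonneg (by rw [le_div_iff₀ (by norm_num : (0:ℝ) < 4)]; linarith)
  refine mul_le_mul_of_nonneg_right ?_ hlog
  have hθ0 : 0 < t + (1 - t) * (1 - w 0) := touchRateSum_pos ht0 ht1 (weight_zero_le_one hw0 hw1)
  have hθ1 : t + (1 - t) * (1 - w 0) ≤ 1 := by nlinarith [hw0 0, weight_zero_le_one hw0 hw1]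
  have hKθ : (K : ℝ) ≤ (K : ℝ) / (t + (1 - t) * (1 - w 0)) := by
    rw [le_div_iff₀ hθ0]; nlinarith
  linarith

/-- **UNIFORM LISTING (`m = cK`) WITH A DOEBLIN-MINORISED HOT SAMPLER: `t_mix(ε) ≤ ⌈(2K/(tp))·log((2K+p)/(pε))⌉`**
once `4t ≤ p(1−t)·a·w_0` (`μ_k`-stationary kernels, `0 < t`). [ours] -/
theorem doeblinStar_mixingTime_le_uniform (ht0 : 0 < t) (ht1 : t ≤ 1) (hw0 : ∀ k, 0 ≤ w k) (hw1 : ∑ k, w k = 1)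
    (hμ : ∀ k x, 0 < μ k x) (hμ1 : ∀ k, ∑ u, μ k u = 1) (hM : ∀ k, IsRowStochastic (M k))
    (hstat : ∀ (k : Fin (K + 1)) (v : S), ∑ u, μ k u * M k u v = μ k v) (ha0 : 0 < a) (ha1 : a ≤ 1)
    (hmin : ∀ u v, a * μ 0 v ≤ M 0 u v) (hp0 : 0 < p) (hp1 : p ≤ 1)
    (hdom : ∀ r u, p * μ (κ r).succ (φ r u) ≤ μ 0 u) (hreg : 4 * t ≤ p * (1 - t) * (a * w 0)) {c : ℕ} (hc1 : 1 ≤ c)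
    (hK : 1 ≤ K) (hc : ∀ p' : Fin K, c ≤ (univ.filter (fun r : Fin m => κ r = p')).card) (hmc : m = c * K)
    {ε : ℝ} (hε : 0 < ε) :
    mixingTime (fun y z : Fin (K + 1) → S =>
        t * ptGraphSwap μ (fun r : Fin m => (((0 : Fin (K + 1)), (κ r).succ) : Fin (K + 1) × Fin (K + 1))) φ y z
          + (1 - t) * prodKernel w M y z) (tensorFun μ) ε
      ≤ ⌈2 * (K : ℝ) / (t * p) * Real.log ((2 * (K : ℝ) + p) / (p * ε))⌉₊ := by
  have hm : 1 ≤ m := by rw [hmc]; exact Nat.one_le_iff_ne_zero.mpr (Nat.mul_ne_zero (by omega) (by omega))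
  have hcm : c ≤ m := by rw [hmc]; exact Nat.le_mul_of_pos_right c (by omega)
  have h := doeblinStar_mixingTime_le κ φ hm ht0 ht1 hw0 hw1 hμ hμ1 hM hstat ha0 ha1 hmin hp0 hp1 hdom hreg hc1 hc hcm hε
  have hcpos : (0 : ℝ) < c := Nat.cast_pos.mpr (by omega)
  have e : 2 * (m : ℝ) / (t * c * p) = 2 * (K : ℝ) / (t * p) := by
    rw [hmc, Nat.cast_mul]
    field_simp
  rwa [e] at h

/-! ## §2 The tuned hot-only star: `w_0 = 1`, `t = pa/(4+pa)`, `m = cK` -/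

/-- **THE TUNED STAR WITH A DOEBLIN-MINORISED HOT SAMPLER, BOTH SIDES:** hot-only updates, swap fraction
`t = pa/(4+pa)` (the regime `4t ≤ p(1−t)·a·w_0` with equality), `m = cK`, `K ≥ 2`, reversible kernels, one-sided
domination, a start `x` with `Σ_k μ_{k+1}(x_{k+1}) ≤ 1/4`:
**`((4+pa)K/(pa) − 1)·log(K/4) ≤ t_mix(1/4) ≤ ⌈(2(4+pa)K/(p²a))·log((2K+p)/(p·(1/4)))⌉`.** [ours] -/
theorem doeblinTunedStar_mixingTime_two_sided (hK : 2 ≤ K) (hμ : ∀ k x, 0 < μ k x) (hμ1 : ∀ k, ∑ u, μ k u = 1)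
    (hM : ∀ k, IsRowStochastic (M k)) (hMrev : ∀ k, DetailedBalance (μ k) (M k)) (ha0 : 0 < a) (ha1 : a ≤ 1)
    (hmin : ∀ u v, a * μ 0 v ≤ M 0 u v) (hp0 : 0 < p) (hp1 : p ≤ 1) (hdom : ∀ r u, p * μ (κ r).succ (φ r u) ≤ μ 0 u)
    {c : ℕ} (hc1 : 1 ≤ c) (hc : ∀ p' : Fin K, c ≤ (univ.filter (fun r : Fin m => κ r = p')).card) (hmc : m = c * K)
    (x : Fin (K + 1) → S) (hx : ∑ k : Fin K, μ k.succ (x k.succ) ≤ 1 / 4) :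
    ((4 + p * a) * (K : ℝ) / (p * a) - 1) * Real.log (K / 4)
        ≤ (mixingTime (fun y z : Fin (K + 1) → S =>
            p * a / (4 + p * a)
                * ptGraphSwap μ (fun r : Fin m => (((0 : Fin (K + 1)), (κ r).succ) : Fin (K + 1) × Fin (K + 1))) φ y z
              + (1 - p * a / (4 + p * a)) * prodKernel (fun k : Fin (K + 1) => if k = 0 then (1 : ℝ) else 0) M y z)
            (tensorFun μ) (1 / 4) : ℝ) ∧
      mixingTime (fun y z : Fin (K + 1) → S =>
            p * a / (4 + p * a)
                * ptGraphSwap μ (fun r : Fin m => (((0 : Fin (K + 1)), (κ r).succ) : Fin (K + 1) × Fin (K + 1))) φ y z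
              + (1 - p * a / (4 + p * a)) * prodKernel (fun k : Fin (K + 1) => if k = 0 then (1 : ℝ) else 0) M y z)
            (tensorFun μ) (1 / 4)
        ≤ ⌈2 * (4 + p * a) * (K : ℝ) / (p ^ 2 * a) * Real.log ((2 * (K : ℝ) + p) / (p * (1 / 4)))⌉₊ := by
  have hm : 1 ≤ m := by rw [hmc]; exact Nat.one_le_iff_ne_zero.mpr (Nat.mul_ne_zero (by omega) (by omega))
  have hcm : c ≤ m := by rw [hmc]; exact Nat.le_mul_of_pos_right c (by omega)
  have hw0 : ∀ k : Fin (K + 1), 0 ≤ (if k = 0 then (1 : ℝ) else 0) := fun k => by split_ifs <;> norm_num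
  have hw1 : ∑ k : Fin (K + 1), (if k = 0 then (1 : ℝ) else 0) = 1 := by
    rw [Finset.sum_ite_eq' univ (0 : Fin (K + 1)), if_pos (mem_univ _)]
  have hpa : 0 < p * a := mul_pos hp0 ha0
  have h4p : 0 < 4 + p * a := by linarith
  have ht0 : 0 < p * a / (4 + p * a) := div_pos hpa h4p
  have ht1 : p * a / (4 + p * a) ≤ 1 := by rw [div_le_one h4p]; linarith
  have hreg : 4 * (p * a / (4 + p * a))
      ≤ p * (1 - p * a / (4 + p * a)) * (a * (if (0 : Fin (K + 1)) = 0 then (1 : ℝ) else 0)) := by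
    rw [if_pos rfl, mul_one]
    have e : p * (1 - p * a / (4 + p * a)) * a = 4 * (p * a / (4 + p * a)) := by field_simp; ring
    rw [e]
  have h := doeblinStar_mixingTime_two_sided κ φ hK hm ht0 ht1 hw0 hw1 hμ hμ1 hM hMrev ha0 ha1 hmin hp0 hp1 hdom hreg
    hc1 hc hcm x hx
  have hcpos : (0 : ℝ) < c := Nat.cast_pos.mpr (by omega)
  have e0 : p * a / (4 + p * a) + (1 - p * a / (4 + p * a)) * (1 - (if (0 : Fin (K + 1)) = 0 then (1 : ℝ) else 0))
      = p * a / (4 + p * a) := by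
    rw [if_pos rfl]; ring
  have e1 : (K : ℝ) / (p * a / (4 + p * a)) = (4 + p * a) * (K : ℝ) / (p * a) := by
    rw [div_div_eq_mul_div]; ring
  have e2 : 2 * (m : ℝ) / (p * a / (4 + p * a) * c * p) = 2 * (4 + p * a) * (K : ℝ) / (p ^ 2 * a) := by
    rw [hmc, Nat.cast_mul, div_eq_div_iff (by positivity) (by positivity)]
    field_simp
  rw [e0, e1, e2] at h
  exact h

/-- **THE TUNED STAR WITH A DOEBLIN-MINORISED HOT SAMPLER ON A LARGE CONFIGURATION SPACE (`|S| ≥ 4K`, `K ≥ 4`):**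
**`(K − 1)·log(K/4) ≤ t_mix(1/4) ≤ ⌈(2(4+pa)K/(p²a))·log((2K+p)/(p·(1/4)))⌉`** with the rare start supplied. [ours] -/
theorem doeblinTunedStar_mixingTime_two_sided_of_card (hK : 4 ≤ K) (hS : 4 * K ≤ Fintype.card S)
    (hμ : ∀ k x, 0 < μ k x) (hμ1 : ∀ k, ∑ u, μ k u = 1) (hM : ∀ k, IsRowStochastic (M k))
    (hMrev : ∀ k, DetailedBalance (μ k) (M k)) (ha0 : 0 < a) (ha1 : a ≤ 1) (hmin : ∀ u v, a * μ 0 v ≤ M 0 u v)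
    (hp0 : 0 < p) (hp1 : p ≤ 1) (hdom : ∀ r u, p * μ (κ r).succ (φ r u) ≤ μ 0 u)
    {c : ℕ} (hc1 : 1 ≤ c) (hc : ∀ p' : Fin K, c ≤ (univ.filter (fun r : Fin m => κ r = p')).card) (hmc : m = c * K) :
    ((K : ℝ) - 1) * Real.log (K / 4)
        ≤ (mixingTime (fun y z : Fin (K + 1) → S =>
            p * a / (4 + p * a)
                * ptGraphSwap μ (fun r : Fin m => (((0 : Fin (K + 1)), (κ r).succ) : Fin (K + 1) × Fin (K + 1))) φ y z
              + (1 - p * a / (4 + p * a)) * prodKernel (fun k : Fin (K + 1) => if k = 0 then (1 : ℝ) else 0) M y z)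
            (tensorFun μ) (1 / 4) : ℝ) ∧
      mixingTime (fun y z : Fin (K + 1) → S =>
            p * a / (4 + p * a)
                * ptGraphSwap μ (fun r : Fin m => (((0 : Fin (K + 1)), (κ r).succ) : Fin (K + 1) × Fin (K + 1))) φ y z
              + (1 - p * a / (4 + p * a)) * prodKernel (fun k : Fin (K + 1) => if k = 0 then (1 : ℝ) else 0) M y z)
            (tensorFun μ) (1 / 4)
        ≤ ⌈2 * (4 + p * a) * (K : ℝ) / (p ^ 2 * a) * Real.log ((2 * (K : ℝ) + p) / (p * (1 / 4)))⌉₊ := by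
  obtain ⟨x, hx⟩ := exists_rare_coldStart (μ := μ) hμ1 hS
  obtain ⟨hlo, hhi⟩ := doeblinTunedStar_mixingTime_two_sided κ φ (by omega) hμ hμ1 hM hMrev ha0 ha1 hmin hp0 hp1 hdom
    hc1 hc hmc x hx
  refine ⟨le_trans ?_ hlo, hhi⟩
  have hK4 : (4 : ℝ) ≤ K := by exact_mod_cast hK
  have hlog : 0 ≤ Real.log (K / 4) := Real.log_nonneg (by rw [le_div_iff₀ (by norm_num : (0:ℝ) < 4)]; linarith)
  refine mul_le_mul_of_nonneg_right ?_ hlog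
  have hpa : 0 < p * a := mul_pos hp0 ha0
  have hpa1 : p * a ≤ 1 := by nlinarith
  have hKp : (K : ℝ) ≤ (4 + p * a) * (K : ℝ) / (p * a) := by
    rw [le_div_iff₀ hpa]; nlinarith
  linarith

end Law

end Summit.Ventures.LatticeQCDFlow.Scaling

end
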